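import Literature.AlgebraicGeometry.ShimuraVarieties.UnitaryBallSpecialCurveDatumOfCode
import Literature.AlgebraicGeometry.ShimuraVarieties.UnitaryShimuraCurveEmbeddingInjective
import Literature.AlgebraicGeometry.ShimuraVarieties.UnitaryBallDiscontinuity
import Literature.AlgebraicGeometry.ShimuraVarieties.UnitaryBallH1RestrictionSubfieldCode
import HarnessLib

/-!
# Injective `embPoints` ⇒ no self-intersection of the special curve at the framed line (road (ii), leaf L3.3 (c), `hinj` seam)

Topic `AlgebraicGeometry/ShimuraVarieties`, namespace `…ShimuraVarieties.UnitaryBallUniformisationDatum`.  THEOREMS ONLY (no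
definition, no named fact, no instance, no `sorry`).  Cell `hodgecm-mathlib`, road (ii) «embedded-curve descent» of the census
«GS-3 ⇐ #62»; books 0 — nothing here is a proof of GS-3.

SETTING.  A piece `D : UnitaryBallUniformisationDatum 2 Xq` of the complex surface `(M_K)_τ`, CODED over the CM field `L` by
`e : L ≃+* D.E` over `τ` (`D.H = H^e`, `D.Γ = Γ_H(g_q K g_q⁻¹)^e` — the `pieces` clause of the surface record, pinned in
subfield-code currency), an `L`-frame `ᵗ(cB)·(a·H)·B = J⋆ ⊕ᶠ J⊥` (`τ a` a positive real, `Re τ(J⊥₀₀) > 0`), a curve representative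
`g⋆ ∈ U(J⋆)(𝔸_{L⁺,f})` with its bookkeeper `γ_r ∈ U(H)(L⁺)`, `g_q⁻¹ γ_{r,f} φGS(g⋆) ∈ K`, so that the special curve of the piece
attached to `g⋆` is the one of the line `W = D.E·(B′e₃)`, `B′ = GL(e)(γ_r B)`; the curve's arithmetic level
`Γ₁ = Γ_{J⋆}(g⋆ K⋆ g⋆⁻¹)` JOINED to `D.Γ` along `B′` (`B′(GL(e)γ₁ ⊕ 1)B′⁻¹ ∈ D.Γ`, the `hΓ₁Γ` clause of
★ `exists_specialCurveDatum_of_subfieldCode`); and the embedding of Shimura SETS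
`embPoints : Sh_{K⋆}(U(J⋆), 𝔻)(ℂ) → Sh_K(U(H), 𝔹²)(ℂ)` INJECTIVE (★ F-INJ `ShimuraSetGS.embPoints_injective_of_le_levelB`).

RESULT `UnitaryBallUniformisationDatum.mem_lineStab_of_smul_mem_specialBall_of_embPoints_injective` — **the `hinj` binder of
★ `exists_specialCurveDatum_of_subfieldCode`, discharged**: every `γ ∈ D.Γ` carrying SOME point of the sub-ball `𝔹(W^⊥)` into
`𝔹(W^⊥)` stabilises the line `W` ([Deligne1971TravauxShimura] Prop. 1.15: at an injective level the immersed special curve has no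
self-intersection).  PROOF, on Shimura SETS only (no pieces, no uniformisation): the two sub-ball points have cone lifts
`∝ B′^τ(v ⊕ 0)`, `∝ B′^τ(v′ ⊕ 0)` (★ `exists_coneLift_eq_embMatrix_mulVec`); `γ = e(δ)`, `δ ∈ Γ_H(g_q K g_q⁻¹)`, and `δ^τ`
carries one lift to a multiple of the other (★ `exists_act_coneLift_eq_smul`); conjugating by `γ_r` and using the bookkeeper gives a
COINCIDENCE WITNESS `embPoints [v′, g⋆K⋆] = embPoints [v, g⋆K⋆]` (★ `ShimuraSetGS.embPoints_mk_eq_embPoints_mk_iff`); injectivity and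
★ `ShimuraSetGS.mk_eq_mk_iff` give `ρ ∈ Γ_{J⋆}(g⋆ K⋆ g⋆⁻¹)` with `c·ρ^τ v = v′`; `ρ̃ = B′(e ρ ⊕ 1)B′⁻¹ ∈ D.Γ` stabilises `W`
(★ `conj_blockDiag_mem_lineStab`) and moves `z` to `γ z` (★ `map_conj_blockDiag_mul_embMatrix`, `coneChart_act`), so `γ⁻¹ρ̃`
FIXES a ball point, hence `γ = ρ̃` (★ `UnitaryBallDiscontinuity.eq_one_of_smul_eq`: torsion-free `Γ` acts freely).

## References
* [Deligne1971TravauxShimura] P. Deligne, *Travaux de Shimura*, Sém. Bourbaki 389 (1971), Prop. 1.15 and its proof pp. 132–133.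
* [Milne2005ShimuraVarieties] J. S. Milne, *Introduction to Shimura varieties* (2005/2017), §5 (5.1) p. 56, Lemma 5.13 p. 57, Thm. 5.16 p. 59.
* [BergeronMillsonMoeglin2016Balls] N. Bergeron, J. Millson, C. Moeglin, Acta Math. 216 (2016), Part 2 §§1.1–1.3, 3.1–3.3.
* [KudlaMillson1990] S. Kudla, J. Millson, Publ. Math. IHÉS 71 (1990), Lemma 1.1 p. 128.
* [Liu2021] Y. Liu, Camb. J. Math. 9 (2021), proof of Thm. 4.15 (FJcycle.tex l. 2193–2208).
-/

set_option autoImplicit false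

noncomputable section

open scoped ComplexOrder
open Matrix Complex NumberField Set Function MulAction
open Literature.Geometry.ComplexHyperbolic Literature.Geometry.ComplexHyperbolic.BallModel
open Literature.NumberTheory.Automorphic Literature.NumberTheory.Automorphic.UnitaryGroup
open Literature.AlgebraicGeometry.Motives (SchemeOver ComplexPoints)
open Literature.AlgebraicGeometry.ShimuraVarieties.UnitaryCanonicalModel

namespace Literature.AlgebraicGeometry.ShimuraVarieties

namespace UnitaryBallUniformisationDatum

variable {L : Type} [Field L] [NumberField L] [IsCMField L] (τ : L →+* ℂ)
  {Xq : SchemeOver ℂ} (D : UnitaryBallUniformisationDatum 2 Xq)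
  (e : L ≃+* ↥D.E) (he : ∀ x : L, ((e x : ↥D.E) : ℂ) = τ x)
  {H : Matrix (Fin 3) (Fin 3) L} (hH : D.H = H.map e.toRingHom)
  {T : GL (Fin 3) ℂ} (hT : formCongr (starRingEnd ℂ) T (H.map τ) = BallModel.J)
  {Jstar : Matrix (Fin 2) (Fin 2) L} (Jperp : Matrix (Fin 1) (Fin 1) L) (B : GL (Fin 3) L) {a : L} (ha : a ≠ 0)
  (hB : formCongr ((IsCMField.complexConj L : L ≃ₐ[↥(maximalRealSubfield L)] L) : L →+* L) B (a • H) = finSum 2 1 Jstar Jperp)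
  (hτa : 0 < (τ a).re) (hτa' : (τ a).im = 0) (hpos : 0 < (τ (Jperp 0 0)).re)
  {Kstar : Subgroup ↥(finAdelic (↥(maximalRealSubfield L)) L (IsCMField.complexConj L) 2 Jstar)}
  {K : Subgroup ↥(finAdelic (↥(maximalRealSubfield L)) L (IsCMField.complexConj L) 3 H)}
  (hK : Kstar.map (φGS L Jstar Jperp H B ha hB) ≤ K)
  (gq : ↥(finAdelic (↥(maximalRealSubfield L)) L (IsCMField.complexConj L) 3 H))
  (hΓ : D.Γ = (arithmeticLevel (↥(maximalRealSubfield L)) L (IsCMField.complexConj L) 3 H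
    (K.map (MulAut.conj gq).toMonoidHom)).map (Matrix.GeneralLinearGroup.map e.toRingHom))
  (gs : ↥(finAdelic (↥(maximalRealSubfield L)) L (IsCMField.complexConj L) 2 Jstar))
  (γr : ↥(rational (↥(maximalRealSubfield L)) L (IsCMField.complexConj L) 3 H))
  (hγ : gq⁻¹ * (rationalToFinAdelic (↥(maximalRealSubfield L)) L (IsCMField.complexConj L) 3 H γr *
    φGS L Jstar Jperp H B ha hB gs) ∈ K)
  (𝔣 : D.SylvesterFrame)

omit [NumberField L] [IsCMField L] in
/-- `(γ B)^τ(v ⊕ 0) = γ^τ · B^τ(v ⊕ 0)` (in-file twin of the private lemma of ★ `UnitaryShimuraCurveEmbeddingComplex`).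
[cite: Liu2021, Thm. 4.15 proof (FJcycle.tex l. 2193–2203)] -/
private theorem frameEmbNeg_mul'' (γ B : GL (Fin 3) L) (v : Fin 2 → ℂ) :
    frameEmbNeg τ (γ * B) v = ((γ : Matrix (Fin 3) (Fin 3) L).map τ) *ᵥ frameEmbNeg τ B v := by
  unfold frameEmbNeg
  rw [Units.val_mul, Matrix.map_mul, mulVec_mulVec]

/-- **A frame translated by a rational isometry is a frame with the same Gram data**: `ᵗ(c(γB))·(a·H)·(γB) = ᵗ(cB)·(a·H)·B` for
`γ ∈ U(H)(L⁺)` (in-file twin of ★ `formCongr_mul_of_mem_rational`, kept private to spare the import).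
[cite: BergeronMillsonMoeglin2016Balls, Part 2 §1.2 and §3.1] -/
private theorem formCongr_mul_of_mem_rational' (γ : ↥(rational (↥(maximalRealSubfield L)) L (IsCMField.complexConj L) 3 H))
    (B : GL (Fin 3) L) (a : L) :
    formCongr ((IsCMField.complexConj L : L ≃ₐ[↥(maximalRealSubfield L)] L) : L →+* L) ((γ : GL (Fin 3) L) * B) (a • H) =
      formCongr ((IsCMField.complexConj L : L ≃ₐ[↥(maximalRealSubfield L)] L) : L →+* L) B (a • H) := by
  have hγ := mem_unitaryGroupOfForm_iff.1 γ.2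
  have hγa : (((γ : GL (Fin 3) L) : Matrix (Fin 3) (Fin 3) L).map
        ((IsCMField.complexConj L : L ≃ₐ[↥(maximalRealSubfield L)] L) : L →+* L))ᵀ * (a • H) *
        ((γ : GL (Fin 3) L) : Matrix (Fin 3) (Fin 3) L) = a • H := by
    rw [Matrix.mul_smul, Matrix.smul_mul, hγ]
  calc formCongr ((IsCMField.complexConj L : L ≃ₐ[↥(maximalRealSubfield L)] L) : L →+* L) ((γ : GL (Fin 3) L) * B) (a • H)
      = ((B : Matrix (Fin 3) (Fin 3) L).map ((IsCMField.complexConj L : L ≃ₐ[↥(maximalRealSubfield L)] L) : L →+* L))ᵀ *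
          ((((γ : GL (Fin 3) L) : Matrix (Fin 3) (Fin 3) L).map
            ((IsCMField.complexConj L : L ≃ₐ[↥(maximalRealSubfield L)] L) : L →+* L))ᵀ * (a • H) *
            ((γ : GL (Fin 3) L) : Matrix (Fin 3) (Fin 3) L)) * (B : Matrix (Fin 3) (Fin 3) L) := by
        simp only [formCongr, Units.val_mul, Matrix.map_mul, Matrix.transpose_mul, Matrix.mul_assoc]
    _ = formCongr ((IsCMField.complexConj L : L ≃ₐ[↥(maximalRealSubfield L)] L) : L →+* L) B (a • H) := by
        rw [hγa]

/-- **Conjugating a coincidence**: `Δ (Γ x) = c · Γ y` with `c ≠ 0` gives `y = c⁻¹ · (Γ⁻¹ Δ Γ) x` (matrix bookkeeping for the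
coincidence witness). [folklore] -/
private theorem eq_inv_smul_conj_mulVec {Γm Δm : GL (Fin 3) ℂ} {x y : Fin 3 → ℂ} {c : ℂ} (hc : c ≠ 0)
    (h : (Δm : Matrix (Fin 3) (Fin 3) ℂ) *ᵥ ((Γm : Matrix (Fin 3) (Fin 3) ℂ) *ᵥ x) = c • ((Γm : Matrix (Fin 3) (Fin 3) ℂ) *ᵥ y)) :
    y = c⁻¹ • (((Γm⁻¹ * Δm * Γm : GL (Fin 3) ℂ) : Matrix (Fin 3) (Fin 3) ℂ) *ᵥ x) := by
  rw [Units.val_mul, Units.val_mul, ← mulVec_mulVec, ← mulVec_mulVec, h, mulVec_smul, mulVec_mulVec, ← Units.val_mul,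
    inv_mul_cancel, Units.val_one, one_mulVec, smul_smul, inv_mul_cancel₀ hc, one_smul]

include he hH hT hτa hτa' hpos hK hΓ hγ in
/-- **Injective `embPoints` ⇒ the `hinj` clause of the special curve at the framed line** ([Deligne1971TravauxShimura] Prop. 1.15:
no self-intersection at an injective level).  With the setting of the module docstring, if `embPoints : Sh_{K⋆}(U(J⋆))(ℂ) →
Sh_K(U(H))(ℂ)` is injective and the curve level `Γ_{J⋆}(g⋆ K⋆ g⋆⁻¹)` is joined to `D.Γ` along `B′ = GL(e)(γ_r B)`, then every
`γ ∈ D.Γ` which carries some point of the sub-ball `𝔹(W^⊥)`, `W = D.E·(B′e₃)`, into `𝔹(W^⊥)` lies in the stabiliser `Γ_W` — the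
hypothesis `hinj` of ★ `exists_specialCurveDatum_of_subfieldCode` at `BL := γ_r B`, token for token.
[cite: Deligne1971TravauxShimura, Prop. 1.15 and proof pp. 132–133] [cite: Milne2005ShimuraVarieties, §5 (5.1) p. 56 and Lemma 5.13 p. 57]
[cite: KudlaMillson1990, Lemma 1.1 p. 128] [cite: BergeronMillsonMoeglin2016Balls, Part 2 §§1.3, 3.3] -/
theorem mem_lineStab_of_smul_mem_specialBall_of_embPoints_injective
    (hΓ₁Γ : ∀ γ₁ ∈ arithmeticLevel (↥(maximalRealSubfield L)) L (IsCMField.complexConj L) 2 Jstar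
        (Kstar.map (MulAut.conj gs).toMonoidHom),
      Matrix.GeneralLinearGroup.map e.toRingHom ((γr : GL (Fin 3) L) * B) *
        reindexGL finSumFinEquiv (blockDiagGL (Matrix.GeneralLinearGroup.map e.toRingHom γ₁, (1 : GL (Fin 1) ↥D.E))) *
        (Matrix.GeneralLinearGroup.map e.toRingHom ((γr : GL (Fin 3) L) * B))⁻¹ ∈ D.Γ)
    (hinj : Function.Injective (ShimuraSetGS.embPoints L H τ T hT Jstar Jperp B ha hB hτa hτa' Kstar K hK)) :
    ∀ γ : D.Γ, (∃ z ∈ D.specialBall 𝔣 {fun i =>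
        ((Matrix.GeneralLinearGroup.map e.toRingHom ((γr : GL (Fin 3) L) * B) : GL (Fin 3) ↥D.E) :
          Matrix (Fin 3) (Fin 3) ↥D.E) i (Fin.last 2)},
        D.ballRep 𝔣 γ • z ∈ D.specialBall 𝔣 {fun i =>
          ((Matrix.GeneralLinearGroup.map e.toRingHom ((γr : GL (Fin 3) L) * B) : GL (Fin 3) ↥D.E) :
            Matrix (Fin 3) (Fin 3) ↥D.E) i (Fin.last 2)}) →
      γ ∈ D.lineStab (D.E ∙ fun i =>
        ((Matrix.GeneralLinearGroup.map e.toRingHom ((γr : GL (Fin 3) L) * B) : GL (Fin 3) ↥D.E) :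
          Matrix (Fin 3) (Fin 3) ↥D.E) i (Fin.last 2)) := by
  -- NOTATION: the transported frame `B′ = GL(e)(γ_r B)`, the coded forms `J⋆′ = (a⁻¹J⋆)^e`, `J⊥′ = (a⁻¹J⊥)^e`
  set B' : GL (Fin 3) ↥D.E := Matrix.GeneralLinearGroup.map e.toRingHom ((γr : GL (Fin 3) L) * B) with hB'def
  set Jstar' : Matrix (Fin 2) (Fin 2) ↥D.E := (a⁻¹ • Jstar).map e with hJstar'
  set Jperp' : Matrix (Fin 1) (Fin 1) ↥D.E := (a⁻¹ • Jperp).map e with hJperp'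
  -- the `L`-frame `γ_r B` of `a • H` (`U(H)(L⁺)` acts on frames) and its transport along the code
  have hBL : formCongr (IsCMField.complexConj L).toRingEquiv.toRingHom ((γr : GL (Fin 3) L) * B) (a • H) =
      finSum 2 1 Jstar Jperp := by
    have h := formCongr_mul_of_mem_rational' (H := H) γr B a
    rw [hB] at h
    exact h
  have hB' : formCongr (conjRingHom D.E) B' D.H = finSum 2 1 Jstar' Jperp' :=
    D.formCongr_glMap_code_eq_finSum τ e he hH ((γr : GL (Fin 3) L) * B) ha Jstar Jperp hBL
  have hJ : D.E.subtype (Jperp' 0 0) ≠ 0 := fun h0 => by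
    have h := D.re_pos_code_subformRight τ e he Jperp (a := a) hτa hτa' hpos
    rw [← hJperp', h0, Complex.zero_re] at h
    exact lt_irrefl _ h
  -- negativity for `J⋆′^{τ₁} = (τ a)⁻¹ · J⋆^τ` is negativity for `J⋆^τ`
  have hneg : ∀ w : Fin 2 → ℂ, w ∈ negCone (Jstar'.map D.E.subtype) → w ∈ negCone (Jstar.map τ) := by
    intro w hw
    have hreal : ((τ a)⁻¹ : ℂ) = (((τ a).re⁻¹ : ℝ) : ℂ) := by
      rw [Complex.ofReal_inv]
      congr 1
      exact Complex.ext rfl (by rw [Complex.ofReal_im]; exact hτa')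
    rwa [hJstar', D.map_code_smul_map_subtype τ e he Jstar, hreal, negCone_real_smul (inv_pos.2 hτa)] at hw
  -- the embedding matrix `M = τ₁(B′(e₁|e₂))` is `v ↦ (γ_r B)^τ(v ⊕ 0) = γ_r^τ · B^τ(v ⊕ 0)`
  have hM : ∀ w : Fin 2 → ℂ, (((B' : Matrix (Fin 3) (Fin 3) ↥D.E).submatrix id Fin.castSucc).map D.E.subtype) *ᵥ w =
      (((γr : GL (Fin 3) L) : Matrix (Fin 3) (Fin 3) L).map τ) *ᵥ frameEmbNeg τ B w := fun w => by
    rw [D.embMatrix_mulVec_eq_map_mulVec_append B' w, hB'def, D.coe_glMap_ringEquiv_map_subtype τ e he,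
      ← frameEmbNeg_mul'' τ]
    rfl
  rintro γ ⟨z, hz, hγz⟩
  -- the two sub-ball points come from negative vectors `v`, `v′` of `J⋆^τ`
  obtain ⟨v, hv, hMv⟩ := D.exists_coneLift_eq_embMatrix_mulVec 𝔣 B' Jstar' Jperp' hB' hJ hz
  obtain ⟨v', hv', hMv'⟩ := D.exists_coneLift_eq_embMatrix_mulVec 𝔣 B' Jstar' Jperp' hB' hJ hγz
  have hvτ : v ∈ negCone (Jstar.map τ) := hneg v hv
  have hv'τ : v' ∈ negCone (Jstar.map τ) := hneg v' hv'
  rw [hM] at hMv hMv'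
  -- `γ = e(δ)` with `δ ∈ Γ_H(g_q K g_q⁻¹)`: `δ` rational and `δ_f = g_q k g_q⁻¹`, `k ∈ K`
  have hγmem : (γ : GL (Fin 3) ↥D.E) ∈ (arithmeticLevel (↥(maximalRealSubfield L)) L (IsCMField.complexConj L) 3 H
      (K.map (MulAut.conj gq).toMonoidHom)).map (Matrix.GeneralLinearGroup.map e.toRingHom) := by
    rw [← hΓ]; exact γ.2
  obtain ⟨δ, hδ, hδγ⟩ := Subgroup.mem_map.mp hγmem
  obtain ⟨hδrat, hδK⟩ := mem_arithmeticLevel_iff.mp hδ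
  obtain ⟨k, hk, hkδ⟩ := Subgroup.mem_map.mp hδK
  rw [MulEquiv.coe_toMonoidHom, MulAut.conj_apply] at hkδ
  set δ' : ↥(rational (↥(maximalRealSubfield L)) L (IsCMField.complexConj L) 3 H) := ⟨δ, hδrat⟩ with hδ'def
  -- `δ^τ` carries the lift of `z` to a multiple of the lift of `γ z`
  obtain ⟨c, hc, hact⟩ := D.exists_act_coneLift_eq_smul 𝔣 γ z
  have hact' : (((δ' : GL (Fin 3) L) : Matrix (Fin 3) (Fin 3) L).map τ) *ᵥ
      ((((γr : GL (Fin 3) L) : Matrix (Fin 3) (Fin 3) L).map τ) *ᵥ frameEmbNeg τ B v) =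
      c • ((((γr : GL (Fin 3) L) : Matrix (Fin 3) (Fin 3) L).map τ) *ᵥ frameEmbNeg τ B v') := by
    rw [hMv, hMv', ← hact]
    change _ = (((γ : GL (Fin 3) ↥D.E) : Matrix (Fin 3) (Fin 3) ↥D.E).map D.E.subtype) *ᵥ _
    rw [← hδγ, D.coe_glMap_ringEquiv_map_subtype τ e he]
  -- the COINCIDENCE WITNESS `ω = γ_r⁻¹ δ γ_r`: `B^τ(v′ ⊕ 0) = c⁻¹ · ω^τ B^τ(v ⊕ 0)` and `φGS(g⋆)⁻¹ ω_f φGS(g⋆) ∈ K`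
  set ω : ↥(rational (↥(maximalRealSubfield L)) L (IsCMField.complexConj L) 3 H) := γr⁻¹ * δ' * γr with hωdef
  have hball : frameEmbNeg τ B v' = c⁻¹ • (((Matrix.GeneralLinearGroup.map τ (ω : GL (Fin 3) L) : GL (Fin 3) ℂ) :
      Matrix (Fin 3) (Fin 3) ℂ) *ᵥ frameEmbNeg τ B v) := by
    have h := eq_inv_smul_conj_mulVec (Γm := Matrix.GeneralLinearGroup.map τ (γr : GL (Fin 3) L))
      (Δm := Matrix.GeneralLinearGroup.map τ (δ' : GL (Fin 3) L)) hc hact'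
    rw [h, hωdef, Subgroup.coe_mul, Subgroup.coe_mul, Subgroup.coe_inv, map_mul, map_mul, map_inv]
  have hcoset : ((φGS L Jstar Jperp H B ha hB gs)⁻¹ *
      (rationalToFinAdelic (↥(maximalRealSubfield L)) L (IsCMField.complexConj L) 3 H ω * φGS L Jstar Jperp H B ha hB gs) :
        finAdelic (↥(maximalRealSubfield L)) L (IsCMField.complexConj L) 3 H) ∈ K := by
    have hωf : rationalToFinAdelic (↥(maximalRealSubfield L)) L (IsCMField.complexConj L) 3 H ω =
        (rationalToFinAdelic (↥(maximalRealSubfield L)) L (IsCMField.complexConj L) 3 H γr)⁻¹ * (gq * k * gq⁻¹) *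
          rationalToFinAdelic (↥(maximalRealSubfield L)) L (IsCMField.complexConj L) 3 H γr := by
      rw [hωdef, map_mul, map_mul, map_inv, hkδ]
    have hmem := K.mul_mem (K.mul_mem (K.inv_mem hγ) hk) hγ
    have heq : ((φGS L Jstar Jperp H B ha hB gs)⁻¹ *
        (rationalToFinAdelic (↥(maximalRealSubfield L)) L (IsCMField.complexConj L) 3 H ω * φGS L Jstar Jperp H B ha hB gs) :
          finAdelic (↥(maximalRealSubfield L)) L (IsCMField.complexConj L) 3 H) =
        (gq⁻¹ * (rationalToFinAdelic (↥(maximalRealSubfield L)) L (IsCMField.complexConj L) 3 H γr *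
            φGS L Jstar Jperp H B ha hB gs))⁻¹ * k *
          (gq⁻¹ * (rationalToFinAdelic (↥(maximalRealSubfield L)) L (IsCMField.complexConj L) 3 H γr *
            φGS L Jstar Jperp H B ha hB gs)) := by
      rw [hωf]; group
    rw [heq]; exact hmem
  -- hence `embPoints [v′, g⋆K⋆] = embPoints [v, g⋆K⋆]`, and by INJECTIVITY `[v′, g⋆K⋆] = [v, g⋆K⋆]`
  have hemb : ShimuraSetGS.embPoints L H τ T hT Jstar Jperp B ha hB hτa hτa' Kstar K hK (ShimuraSetGS.mk L Jstar τ Kstar v' hv'τ gs) =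
      ShimuraSetGS.embPoints L H τ T hT Jstar Jperp B ha hB hτa hτa' Kstar K hK (ShimuraSetGS.mk L Jstar τ Kstar v hvτ gs) :=
    (ShimuraSetGS.embPoints_mk_eq_embPoints_mk_iff L H τ T hT Jstar Jperp B ha hB hτa hτa' Kstar K hK v' v hv'τ hvτ gs gs).2
      ⟨ω, ⟨c⁻¹, inv_ne_zero hc, hball⟩, hcoset⟩
  obtain ⟨ρ, c₂, hc₂, hρv, hρg⟩ := (ShimuraSetGS.mk_eq_mk_iff L Jstar τ Kstar v' v hv'τ hvτ gs gs).1 (hinj hemb)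
  -- `ρ ∈ Γ_{J⋆}(g⋆ K⋆ g⋆⁻¹)`
  have hρK : gs⁻¹ * (rationalToFinAdelic (↥(maximalRealSubfield L)) L (IsCMField.complexConj L) 2 Jstar ρ * gs) ∈ Kstar := by
    rw [MulAction.Quotient.smul_coe, eq_comm, QuotientGroup.eq] at hρg
    exact hρg
  have hρlev : (ρ : GL (Fin 2) L) ∈ arithmeticLevel (↥(maximalRealSubfield L)) L (IsCMField.complexConj L) 2 Jstar
      (Kstar.map (MulAut.conj gs).toMonoidHom) := by
    refine mem_arithmeticLevel_iff.mpr ⟨ρ.2, Subgroup.mem_map.mpr ⟨_, hρK, ?_⟩⟩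
    rw [MulEquiv.coe_toMonoidHom, MulAut.conj_apply]
    group
  -- `ρ̃ = B′(eρ ⊕ 1)B′⁻¹ ∈ D.Γ` stabilises `W`
  have hρΓ := hΓ₁Γ (ρ : GL (Fin 2) L) hρlev
  have hstab := D.conj_blockDiag_mem_lineStab B' hρΓ
  -- `ρ̃` moves `z` to `γ z`: its action on the lift of `z` is `M(ρ^τ v) = c₂⁻¹ · M v′`
  have hrhoz : D.ballRep 𝔣 ⟨_, hρΓ⟩ • z = D.ballRep 𝔣 γ • z := by
    rw [← D.coneChart_coneLift 𝔣 z, ← D.coneChart_act 𝔣, D.coneChart_coneLift 𝔣 z, ← D.coneChart_coneLift 𝔣 (D.ballRep 𝔣 γ • z),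
      D.coneChart_eq_iff]
    refine ⟨c₂⁻¹, inv_ne_zero hc₂, ?_⟩
    rw [coe_toRealPoints_smul]
    change (((B' * reindexGL finSumFinEquiv (blockDiagGL (Matrix.GeneralLinearGroup.map e.toRingHom (ρ : GL (Fin 2) L),
        (1 : GL (Fin 1) ↥D.E))) * B'⁻¹ : GL (Fin 3) ↥D.E) : Matrix (Fin 3) (Fin 3) ↥D.E).map D.E.subtype) *ᵥ
        ((D.coneLift 𝔣 z : D.cone) : Fin 3 → ℂ) = c₂⁻¹ • ((D.coneLift 𝔣 (D.ballRep 𝔣 γ • z) : D.cone) : Fin 3 → ℂ)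
    have hρmat : ((Matrix.GeneralLinearGroup.map e.toRingHom (ρ : GL (Fin 2) L) : GL (Fin 2) ↥D.E) :
        Matrix (Fin 2) (Fin 2) ↥D.E).map D.E.subtype = (((ρ : GL (Fin 2) L)) : Matrix (Fin 2) (Fin 2) L).map τ := by
      rw [CodeField.coe_glMap_ringEquiv e (ρ : GL (Fin 2) L), CodeField.map_ringEquiv_map_subtype τ e he]
    rw [← hM] at hMv hMv'
    rw [← hMv, ← hMv', mulVec_mulVec, D.map_conj_blockDiag_mul_embMatrix B', ← mulVec_mulVec, hρmat, ← mulVec_smul]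
    congr 1
    rw [← hρv, smul_smul, inv_mul_cancel₀ hc₂, one_smul, coe_ratToGLℂ]
  -- so `γ⁻¹ρ̃` FIXES `z`, hence is trivial (torsion-free `Γ` acts freely), and `γ = ρ̃ ∈ Γ_W`
  have hfix : D.ballRep 𝔣 (γ⁻¹ * ⟨_, hρΓ⟩) • z = z := by
    rw [map_mul, mul_smul, hrhoz, map_inv, inv_smul_smul]
  have hγρ : γ = ⟨_, hρΓ⟩ := inv_mul_eq_one.mp (D.eq_one_of_smul_eq 𝔣 hfix)
  rw [hγρ]
  exact hstab

end UnitaryBallUniformisationDatum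

end Literature.AlgebraicGeometry.ShimuraVarieties

end
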